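import Mathlib
import Summits.MatrixMultiplication.MatrixMultiplication.Theses.PauliSmithLocalisation
import Literature.Computability.AlgebraicComplexity.BorderRankRestriction

/-!
# Line `Sketch` for crux `FixedPointFreeTargets` (stmt-MatrixMultiplication-15042):
the tautological target `SmithPhaseGap → FixedPointFreeTargets`

Skeleton (lead prover).  Composition `FixedPointFreeTargets_of`:

* `stub_target` — for ANY action of a finite abelian group `E` on a space `V` with continuous
  point-separating coordinates (`act 0 = id`, `act (g+h) = act g ∘ act h`, each `act g` continuous)
  there is a linear fixed-point-free target vanishing exactly on the fixed points:
  `f x = (coord t (act g x) - coord t x)_{g ≠ 0, t}`, `ρ h F (g) = F(g+h) - F(h)` (a fixed vector is an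
  additive map `E → ℂ^T`, hence `0` because `E` is torsion), transported to `Fin d`.
* `stub_actZero`, `stub_actAdd`, `stub_actContinuous` — the pinned Pauli sandwich action is a
  continuous action of `E = (F_p^(2k))³`.
* `stub_fixedSpace` — its fixed space is `ℂ · M`, `M = ⟨n,n,n⟩` on `I × I` (`I = Fin k → ZMod p`).
* `stub_borderRank_smul`, `stub_borderRank_matMul` — `bR (c • M) = bR M = bR ⟨p^k,p^k,p^k⟩`.

With `SmithPhaseGap` (item stmt-MatrixMultiplication-9876) giving `(p^k)^(2+δ) < bR ⟨p^k,p^k,p^k⟩`, a zero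
of `f` on `S_r ∖ {0}`, `r ≤ (p^k)^(2+δ)`, would be a non-zero multiple of `M` of border rank `≤ r`:
contradiction.  So the target works at every level `r ≤ (p^k)^(2+δ)`.
-/

set_option linter.dupNamespace false

noncomputable section

namespace Summit.MatrixMultiplication.MatrixMultiplication.Theorems

open scoped BigOperators ComplexConjugate
open Literature.Computability.AlgebraicComplexity

namespace PauliTautologicalTarget

/-! ### Stub 1 — the universal difference target of a finite abelian group action -/

/-- **Universal difference target.**  A continuous action of a finite abelian group `E` on a space
`V` with continuous point-separating coordinates `coord t` admits a representation `ρ` on some `ℂ^d`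
without non-zero fixed vectors and a continuous `ρ`-equivariant `f : V → ℂ^d` vanishing exactly on
the `E`-fixed points (`f x = (coord t (act g x) - coord t x)_{g ≠ 0, t}`, `ρ_h F(g) = F(g+h) - F(h)`).
-/
theorem stub_target {E : Type} [AddCommGroup E] [Fintype E] [DecidableEq E]
    {T : Type} [Fintype T] [DecidableEq T] {V : Type} [TopologicalSpace V]
    (coord : T → V → ℂ) (hcont : ∀ t, Continuous (coord t))
    (hsep : ∀ x y : V, (∀ t, coord t x = coord t y) → x = y)
    (act : E → V → V) (h0 : ∀ x, act 0 x = x)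
    (hadd : ∀ g h x, act (g + h) x = act g (act h x)) (hc : ∀ g, Continuous (act g)) :
    ∃ (d : ℕ) (ρ : E → Matrix (Fin d) (Fin d) ℂ) (f : V → Fin d → ℂ),
      ρ 0 = 1 ∧ (∀ g h, ρ (g + h) = ρ g * ρ h) ∧
      (∀ w : Fin d → ℂ, (∀ g, (ρ g).mulVec w = w) → w = 0) ∧
      Continuous f ∧ (∀ x, f x = 0 → ∀ g, act g x = x) ∧
      (∀ g x, f (act g x) = (ρ g).mulVec (f x)) := by
  sorry

/-! ### Stubs 2–5 — the pinned Pauli sandwich action -/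

section Pinned

variable {p k : ℕ}
  {P : (Fin k → ZMod p) → (Fin k → ZMod p) → Matrix (Fin k → ZMod p) (Fin k → ZMod p) ℂ}
  {act : ((Fin k → ZMod p) × (Fin k → ZMod p)) × ((Fin k → ZMod p) × (Fin k → ZMod p)) ×
      ((Fin k → ZMod p) × (Fin k → ZMod p)) →
    (((Fin k → ZMod p) × (Fin k → ZMod p)) → ((Fin k → ZMod p) × (Fin k → ZMod p)) →
      ((Fin k → ZMod p) × (Fin k → ZMod p)) → ℂ) →
    (((Fin k → ZMod p) × (Fin k → ZMod p)) → ((Fin k → ZMod p) × (Fin k → ZMod p)) →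
      ((Fin k → ZMod p) × (Fin k → ZMod p)) → ℂ)}

/-- The pinned sandwich action at `g = 0` is the identity (`P_(0,0) = 1`). -/
theorem stub_actZero [Fact p.Prime]
    (hP : ∀ x z u v, P x z u v = if u = v + x then
      Complex.exp (2 * Real.pi * Complex.I * ((∑ i, z i * v i).val : ℂ) / (p : ℂ)) else 0)
    (hact : ∀ g x a b c, act g x a b c = ∑ a', ∑ b', ∑ c',
      (starRingEnd ℂ (P g.1.1 g.1.2 a.1 a'.1) * P g.2.2.1 g.2.2.2 a.2 a'.2) *
      (P g.1.1 g.1.2 b.1 b'.1 * starRingEnd ℂ (P g.2.1.1 g.2.1.2 b.2 b'.2)) *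
      (P g.2.1.1 g.2.1.2 c.1 c'.1 * starRingEnd ℂ (P g.2.2.1 g.2.2.2 c.2 c'.2)) * x a' b' c')
    (x : ((Fin k → ZMod p) × (Fin k → ZMod p)) → ((Fin k → ZMod p) × (Fin k → ZMod p)) →
      ((Fin k → ZMod p) × (Fin k → ZMod p)) → ℂ) :
    act 0 x = x := by
  sorry

/-- The pinned sandwich action is additive: `act (g + h) = act g ∘ act h` (Weyl rule
`P_g P_h = χ(z ⬝ x') P_(g+h)`; the projective phases cancel in each conjugate pair of slots). -/
theorem stub_actAdd [Fact p.Prime]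
    (hP : ∀ x z u v, P x z u v = if u = v + x then
      Complex.exp (2 * Real.pi * Complex.I * ((∑ i, z i * v i).val : ℂ) / (p : ℂ)) else 0)
    (hact : ∀ g x a b c, act g x a b c = ∑ a', ∑ b', ∑ c',
      (starRingEnd ℂ (P g.1.1 g.1.2 a.1 a'.1) * P g.2.2.1 g.2.2.2 a.2 a'.2) *
      (P g.1.1 g.1.2 b.1 b'.1 * starRingEnd ℂ (P g.2.1.1 g.2.1.2 b.2 b'.2)) *
      (P g.2.1.1 g.2.1.2 c.1 c'.1 * starRingEnd ℂ (P g.2.2.1 g.2.2.2 c.2 c'.2)) * x a' b' c')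
    (g h : ((Fin k → ZMod p) × (Fin k → ZMod p)) × ((Fin k → ZMod p) × (Fin k → ZMod p)) ×
      ((Fin k → ZMod p) × (Fin k → ZMod p)))
    (x : ((Fin k → ZMod p) × (Fin k → ZMod p)) → ((Fin k → ZMod p) × (Fin k → ZMod p)) →
      ((Fin k → ZMod p) × (Fin k → ZMod p)) → ℂ) :
    act (g + h) x = act g (act h x) := by
  sorry

/-- Each `act g` of the pinned sandwich action is continuous (it is linear in finitely many
coordinates). -/
theorem stub_actContinuous [Fact p.Prime]
    (hact : ∀ g x a b c, act g x a b c = ∑ a', ∑ b', ∑ c',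
      (starRingEnd ℂ (P g.1.1 g.1.2 a.1 a'.1) * P g.2.2.1 g.2.2.2 a.2 a'.2) *
      (P g.1.1 g.1.2 b.1 b'.1 * starRingEnd ℂ (P g.2.1.1 g.2.1.2 b.2 b'.2)) *
      (P g.2.1.1 g.2.1.2 c.1 c'.1 * starRingEnd ℂ (P g.2.2.1 g.2.2.2 c.2 c'.2)) * x a' b' c')
    (g : ((Fin k → ZMod p) × (Fin k → ZMod p)) × ((Fin k → ZMod p) × (Fin k → ZMod p)) ×
      ((Fin k → ZMod p) × (Fin k → ZMod p))) :
    Continuous (act g) := by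
  sorry

/-- **Fixed space of the Pauli sandwich**: an `E`-fixed tensor is a multiple of
`M = ⟨n,n,n⟩` on `I × I` (the commutant of the Weyl–Heisenberg matrices is the scalars, applied in
the three conjugate slot pairs `(a₁,b₁)`, `(b₂,c₁)`, `(c₂,a₂)`). -/
theorem stub_fixedSpace [Fact p.Prime]
    (hP : ∀ x z u v, P x z u v = if u = v + x then
      Complex.exp (2 * Real.pi * Complex.I * ((∑ i, z i * v i).val : ℂ) / (p : ℂ)) else 0)
    (hact : ∀ g x a b c, act g x a b c = ∑ a', ∑ b', ∑ c',
      (starRingEnd ℂ (P g.1.1 g.1.2 a.1 a'.1) * P g.2.2.1 g.2.2.2 a.2 a'.2) *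
      (P g.1.1 g.1.2 b.1 b'.1 * starRingEnd ℂ (P g.2.1.1 g.2.1.2 b.2 b'.2)) *
      (P g.2.1.1 g.2.1.2 c.1 c'.1 * starRingEnd ℂ (P g.2.2.1 g.2.2.2 c.2 c'.2)) * x a' b' c')
    (x : ((Fin k → ZMod p) × (Fin k → ZMod p)) → ((Fin k → ZMod p) × (Fin k → ZMod p)) →
      ((Fin k → ZMod p) × (Fin k → ZMod p)) → ℂ)
    (hx : ∀ g, act g x = x) :
    x = x 0 0 0 • fun a b c : (Fin k → ZMod p) × (Fin k → ZMod p) =>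
      if a.1 = b.1 ∧ b.2 = c.1 ∧ a.2 = c.2 then (1 : ℂ) else 0 := by
  sorry

end Pinned

/-! ### Stubs 6–7 — border rank bookkeeping -/

/-- Border rank is invariant under non-zero scalars (restriction monotonicity both ways). -/
theorem stub_borderRank_smul {K : Type*} [Field K] {ι κ μ : Type*} [Fintype ι] [Fintype κ]
    [Fintype μ] [DecidableEq ι] [DecidableEq κ] [DecidableEq μ] (c : K) (hc : c ≠ 0)
    (t : ι → κ → μ → K) : algBorderRank (c • t) = algBorderRank t := by
  sorry

/-- `bR` of `⟨n,n,n⟩` written on `I × I`, `I = Fin k → ZMod p`, is `bR ⟨p^k,p^k,p^k⟩`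
(relabel along `I ≃ Fin (p^k)`). -/
theorem stub_borderRank_matMul (p k : ℕ) [Fact p.Prime] :
    algBorderRank (fun a b c : (Fin k → ZMod p) × (Fin k → ZMod p) =>
        if a.1 = b.1 ∧ b.2 = c.1 ∧ a.2 = c.2 then (1 : ℂ) else 0) =
      algBorderRank (matMulTensor ℂ (p ^ k) (p ^ k) (p ^ k)) := by
  sorry

/-! ### Composition -/

section Levelwise

variable {p k : ℕ}
  {P : (Fin k → ZMod p) → (Fin k → ZMod p) → Matrix (Fin k → ZMod p) (Fin k → ZMod p) ℂ}
  {act : ((Fin k → ZMod p) × (Fin k → ZMod p)) × ((Fin k → ZMod p) × (Fin k → ZMod p)) ×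
      ((Fin k → ZMod p) × (Fin k → ZMod p)) →
    (((Fin k → ZMod p) × (Fin k → ZMod p)) → ((Fin k → ZMod p) × (Fin k → ZMod p)) →
      ((Fin k → ZMod p) × (Fin k → ZMod p)) → ℂ) →
    (((Fin k → ZMod p) × (Fin k → ZMod p)) → ((Fin k → ZMod p) × (Fin k → ZMod p)) →
      ((Fin k → ZMod p) × (Fin k → ZMod p)) → ℂ)}

/-- **Targets exist at every level below the border rank** (levelwise converse dictionary): for
the pinned Pauli sandwich action at ANY `(p, k)` and every `r < bR ⟨p^k,p^k,p^k⟩` there is a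
fixed-point-free `E`-target on `S_r ∖ {0}` — the universal difference target, whose zeros are the
fixed tensors `c • M`, all of border rank `bR ⟨p^k,p^k,p^k⟩ > r`.  In particular every printed lower
bound for `bR ⟨n,n,n⟩` (e.g. `2n² - ⌈log₂ n⌉ - 1`) yields targets up to that level with no further
work. [cite: tomDieck1987, ch. I] [cite: Blaser2013, §6] -/
theorem targets_of_lt_algBorderRank [Fact p.Prime]
    (hP : ∀ x z u v, P x z u v = if u = v + x then
      Complex.exp (2 * Real.pi * Complex.I * ((∑ i, z i * v i).val : ℂ) / (p : ℂ)) else 0)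
    (hact : ∀ g x a b c, act g x a b c = ∑ a', ∑ b', ∑ c',
      (starRingEnd ℂ (P g.1.1 g.1.2 a.1 a'.1) * P g.2.2.1 g.2.2.2 a.2 a'.2) *
      (P g.1.1 g.1.2 b.1 b'.1 * starRingEnd ℂ (P g.2.1.1 g.2.1.2 b.2 b'.2)) *
      (P g.2.1.1 g.2.1.2 c.1 c'.1 * starRingEnd ℂ (P g.2.2.1 g.2.2.2 c.2 c'.2)) * x a' b' c')
    {r : ℕ} (hr : r < algBorderRank (matMulTensor ℂ (p ^ k) (p ^ k) (p ^ k))) :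
    ∃ (d : ℕ) (ρ : ((Fin k → ZMod p) × (Fin k → ZMod p)) × ((Fin k → ZMod p) × (Fin k → ZMod p)) ×
        ((Fin k → ZMod p) × (Fin k → ZMod p)) → Matrix (Fin d) (Fin d) ℂ)
      (f : (((Fin k → ZMod p) × (Fin k → ZMod p)) → ((Fin k → ZMod p) × (Fin k → ZMod p)) →
        ((Fin k → ZMod p) × (Fin k → ZMod p)) → ℂ) → (Fin d → ℂ)),
      ρ 0 = 1 ∧ (∀ g h, ρ (g + h) = ρ g * ρ h) ∧
      (∀ w : Fin d → ℂ, (∀ g, (ρ g).mulVec w = w) → w = 0) ∧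
      ContinuousOn f {x | x ≠ 0 ∧ algBorderRank x ≤ r} ∧
      (∀ x, x ≠ 0 → algBorderRank x ≤ r → f x ≠ 0) ∧
      (∀ g x, algBorderRank x ≤ r → f (act g x) = (ρ g).mulVec (f x)) := by
  -- the universal target of the pinned action
  obtain ⟨d, ρ, f, h1, h2, h3, h4, h5, h6⟩ :=
    stub_target
      (E := ((Fin k → ZMod p) × (Fin k → ZMod p)) × ((Fin k → ZMod p) × (Fin k → ZMod p)) ×
        ((Fin k → ZMod p) × (Fin k → ZMod p)))
      (T := ((Fin k → ZMod p) × (Fin k → ZMod p)) × ((Fin k → ZMod p) × (Fin k → ZMod p)) ×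
        ((Fin k → ZMod p) × (Fin k → ZMod p)))
      (V := ((Fin k → ZMod p) × (Fin k → ZMod p)) → ((Fin k → ZMod p) × (Fin k → ZMod p)) →
        ((Fin k → ZMod p) × (Fin k → ZMod p)) → ℂ)
      (fun t x => x t.1 t.2.1 t.2.2)
      (fun t => ((continuous_apply t.2.2).comp
        ((continuous_apply t.2.1).comp (continuous_apply t.1))))
      (fun x y hxy => funext fun a => funext fun b => funext fun c => hxy (a, b, c))
      act (stub_actZero hP hact) (stub_actAdd hP hact) (stub_actContinuous hact)
  refine ⟨d, ρ, f, h1, h2, h3, h4.continuousOn, fun x hx0 hxr hfx => ?_, fun g x _ => h6 g x⟩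
  -- a zero of `f` on `S_r ∖ {0}` is a fixed tensor, i.e. a non-zero multiple of `M`
  have hxM := stub_fixedSpace hP hact x (h5 x hfx)
  have hc : x 0 0 0 ≠ 0 := by
    intro hc
    apply hx0
    rw [hxM, hc, zero_smul]
  have hbr : algBorderRank x = algBorderRank (matMulTensor ℂ (p ^ k) (p ^ k) (p ^ k)) := by
    rw [hxM]
    exact (stub_borderRank_smul _ hc _).trans (stub_borderRank_matMul p k)
  -- … of border rank `≤ r < bR ⟨p^k,p^k,p^k⟩ = bR x`: contradiction
  rw [← hbr] at hr
  exact absurd hxr (not_le.2 hr)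

end Levelwise

/-- **The tautological target** (crux `FixedPointFreeTargets`, line `Sketch`; the shared stub of
the crux cards `support-exponent-descent` and `one-step-kronecker-gap`):
`SmithPhaseGap → FixedPointFreeTargets`.  With the universal difference target of the pinned Pauli
sandwich action (zero set = fixed tensors = `ℂ · M`), a zero on `S_r ∖ {0}`,
`r ≤ (p^k)^(2+δ) < bR ⟨p^k,p^k,p^k⟩ = bR M`, is impossible. [cite: tomDieck1987, ch. I]
[cite: Blaser2013, §6] -/
theorem FixedPointFreeTargets_of
    (hGap : Theses.PauliSmithLocalisation.SmithPhaseGap) :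
    Theses.PauliSmithLocalisation.FixedPointFreeTargets := by
  unfold Theses.PauliSmithLocalisation.FixedPointFreeTargets
  obtain ⟨p, hp, δ, hδ, k₀, hk⟩ := hGap
  haveI hpF : Fact p.Prime := ⟨hp⟩
  refine ⟨p, hpF, δ, hδ, k₀, fun k hk₀ P hP act hact r hr => targets_of_lt_algBorderRank hP hact ?_⟩
  -- `r ≤ (p^k)^(2+δ) < bR ⟨p^k,p^k,p^k⟩`
  exact_mod_cast hr.trans_lt (hk k hk₀)

end PauliTautologicalTarget

end Summit.MatrixMultiplication.MatrixMultiplication.Theorems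

end
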